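import Mathlib.LinearAlgebra.Eigenspace.Pi
import Mathlib.LinearAlgebra.Dimension.Finite
import Mathlib.Logic.Equiv.Fintype
import Mathlib.Data.Finset.Powerset
import HarnessLib

/-!
# Lattice rigidity of the Toffoli+Hadamard gate group — Part I: permuted commuting involutions

Support file for the discharge of the barrier fact
`Literature.Barriers.QuantumAdvantage.latticeRigidity_finiteImage` (`LatticeRigidity.lean`).

The elementary representation-theoretic input of the proof: if `A₀, …, A_{N-1}` are pairwise
commuting involutions of a vector space `V` (over a field of characteristic zero) which are permuted
*transitively in the strongest sense* by automorphisms — for every permutation `σ` of the indices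
there is an injective linear map `g_σ` with `g_σ A_i = A_{σ i} g_σ` — and `dim V < N`, then all the
`A_i` coincide.  Applied to the images of the diagonal sign changes `ε_i ∈ O_N(ℤ[1/2])` under a
homomorphism `ρ : O_N(ℤ[1/2]) → GL_d(ℂ)`, `d < N` (the `g_σ` being the images of the permutation
matrices), it says that `ρ(ε_i ε_j) = 1`: every representation of the hyperoctahedral group
`(ℤ/2)^N ⋊ S_N` of dimension `< N` kills the even sign changes.  This is the folklore
Clifford–Mackey computation (the `S_N`-orbit of a character `χ_T` of `(ℤ/2)^N`, `T ≠ ∅, [N]`, has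
`C(N,|T|) ≥ N` elements), written without character theory: a vector on which `A_a` and `A_b`
differ is refined to a joint eigenvector `v` with sign pattern `T ∌ b`, `T ∋ a`; the vectors
`g_σ v` are joint eigenvectors with the `C(N,|T|)` distinct patterns `σ(T)`, hence linearly
independent (Mathlib's `Module.End.independent_iInf_maxGenEigenspace_of_forall_mapsTo`).

## Contents

* `exists_joint_signEigenvector_finset` — refinement of a vector to a joint `±1`-eigenvector of
  finitely many commuting involutions, preserving the relation `A_a A_b v = -v`.
* `le_choose_of_one_le_of_lt` — `N ≤ C(N,k)` for `1 ≤ k ≤ N-1`.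
* `involutions_eq_of_finrank_lt` — the statement above.

## References

* [AmyGlaudellRoss2020] (context only: the group `O_N(ℤ[1/2])` these lemmas are applied to).
  The linear algebra here is folklore.
-/

namespace Literature.Barriers.QuantumAdvantage

open Module Function

variable {K V : Type*} [Field K] [AddCommGroup V] [Module K V]

/-- Refinement to a joint sign-eigenvector: if the `A i` are commuting involutions, `w ≠ 0` and
`A a (A b w) = -w`, then for every finite set `s` of indices there is `v ≠ 0`, still with
`A a (A b v) = -v`, which is a `±1`-eigenvector of every `A i`, `i ∈ s` (replace `v` by
`v + A j v` unless that vanishes, in which case `v` already is a `-1`-eigenvector of `A j`).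
[folklore] -/
theorem exists_joint_signEigenvector_finset {ι : Type*} (A : ι → Module.End K V)
    (hAA : ∀ i v, A i (A i v) = v) (hcomm : ∀ i j v, A i (A j v) = A j (A i v))
    {a b : ι} {w : V} (hw : w ≠ 0) (hab : A a (A b w) = -w) (s : Finset ι) :
    ∃ v : V, v ≠ 0 ∧ A a (A b v) = -v ∧ ∀ i ∈ s, A i v = v ∨ A i v = -v := by
  classical
  induction s using Finset.induction_on with
  | empty => exact ⟨w, hw, hab, by simp⟩
  | insert j s _ ih =>
    obtain ⟨v, hv0, hvab, hvs⟩ := ih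
    by_cases hjv : v + A j v = 0
    · refine ⟨v, hv0, hvab, fun i hi => ?_⟩
      rcases Finset.mem_insert.mp hi with rfl | hi
      · exact Or.inr (eq_neg_of_add_eq_zero_right hjv)
      · exact hvs i hi
    · refine ⟨v + A j v, hjv, ?_, fun i hi => ?_⟩
      · rw [map_add, map_add, hcomm b j, hcomm a j, hvab, map_neg, neg_add]
      · rcases Finset.mem_insert.mp hi with rfl | hi
        · exact Or.inl (by rw [map_add, hAA, add_comm])
        · rcases hvs i hi with h | h
          · exact Or.inl (by rw [map_add, hcomm i j, h])
          · exact Or.inr (by rw [map_add, hcomm i j, h, map_neg, neg_add])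

/-- `N ≤ C(N, k)` for `1 ≤ k ≤ N - 1` (Pascal's rule and induction). [folklore] -/
theorem le_choose_of_one_le_of_lt : ∀ (n k : ℕ), 1 ≤ k → k + 1 ≤ n → n ≤ n.choose k
  | 0, _, _, h => by omega
  | n + 1, 0, hk, _ => by omega
  | _ + 1, 1, _, _ => by simp
  | n + 1, k + 2, _, hkn => by
    rw [Nat.choose_succ_succ']
    by_cases h : k + 2 + 1 ≤ n
    · have h1 := le_choose_of_one_le_of_lt n (k + 1) (by omega) (by omega)
      have h2 := le_choose_of_one_le_of_lt n (k + 1 + 1) (by omega) h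
      omega
    · obtain rfl : n = k + 2 := by omega
      simp [Nat.choose_succ_self_right]

/-- **Permuted commuting involutions below dimension `N` coincide.**  Let `A₀, …, A_{N-1}` be
pairwise commuting involutions of a finite-dimensional vector space `V` over a field of
characteristic zero, and suppose that for every permutation `σ` of `Fin N` some injective linear map
`g σ` satisfies `g σ ∘ A i = A (σ i) ∘ g σ` for all `i`.  If `finrank V < N` then `A a = A b` for
all `a, b`.  (Otherwise a joint `±1`-eigenvector `v` with sign pattern `T`, `a ∈ T ∌ b` say, exists;
the `g σ • v` are joint eigenvectors with the `C(N,|T|) ≥ N` pairwise distinct patterns `σ(T)`,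
hence linearly independent — too many.)  This is the statement that a representation of the
hyperoctahedral group `(ℤ/2)^N ⋊ S_N` of dimension `< N` is trivial on even sign changes.
[folklore] -/
theorem involutions_eq_of_finrank_lt [CharZero K] [FiniteDimensional K V] {N : ℕ}
    (hN : finrank K V < N) (A : Fin N → Module.End K V)
    (hAA : ∀ i, A i * A i = 1) (hcomm : ∀ i j, Commute (A i) (A j))
    (g : Equiv.Perm (Fin N) → Module.End K V) (hg : ∀ σ, Function.Injective (g σ))
    (hconj : ∀ σ i, g σ * A i = A (σ i) * g σ) (a b : Fin N) : A a = A b := by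
  classical
  have hAA' : ∀ i v, A i (A i v) = v := fun i v => by
    rw [← Module.End.mul_apply, hAA, Module.End.one_apply]
  have hcomm' : ∀ i j v, A i (A j v) = A j (A i v) := fun i j v => by
    rw [← Module.End.mul_apply, (hcomm i j).eq, Module.End.mul_apply]
  by_contra hne
  obtain ⟨u, hu⟩ : ∃ u, A a u ≠ A b u := by
    by_contra! h
    exact hne (LinearMap.ext h)
  set w := A a u - A b u with hw_def
  have hw : w ≠ 0 := sub_ne_zero.mpr hu
  have hab : A a (A b w) = -w := by
    simp only [hw_def, map_sub]
    rw [hcomm' b a u, hAA' a, hAA' b, neg_sub]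
  obtain ⟨v, hv0, hvab, hvs⟩ :=
    exists_joint_signEigenvector_finset A hAA' hcomm' hw hab Finset.univ
  -- the sign character of `v`
  set χ : Fin N → K := fun i => if A i v = v then 1 else -1 with hχ_def
  have hχ : ∀ i, A i v = χ i • v := by
    intro i
    by_cases h : A i v = v
    · simp [hχ_def, h]
    · simp only [hχ_def, if_neg h]
      rcases hvs i (Finset.mem_univ i) with h' | h'
      · exact absurd h' h
      · rw [h', neg_one_smul]
  have hχval : ∀ i, χ i = 1 ∨ χ i = -1 := fun i => by
    by_cases h : A i v = v <;> simp [hχ_def, h]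
  have hχab : χ a ≠ χ b := by
    intro h
    have h1 : A a (A b v) = v := by
      rw [hχ b, map_smul, hχ a, smul_smul, h]
      rcases hχval b with hb | hb <;> simp [hb]
    rw [hvab] at h1
    have h2 : (2 : K) • v = 0 := by
      rw [two_smul]
      nth_rewrite 1 [← h1]
      exact neg_add_cancel v
    exact hv0 (by simpa using h2)
  -- the pattern `T` and its size
  set T : Finset (Fin N) := Finset.univ.filter fun i => χ i = -1 with hT
  set k := T.card with hk
  have h1m1 : (1 : K) ≠ -1 := fun h =>
    two_ne_zero (α := K) (by rw [← one_add_one_eq_two]; exact eq_neg_iff_add_eq_zero.mp h)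
  have hk1 : 1 ≤ k ∧ k + 1 ≤ N := by
    have key : ∀ c e : Fin N, χ c = 1 → χ e = -1 → 1 ≤ k ∧ k + 1 ≤ N := by
      intro c e hc he
      refine ⟨Finset.card_pos.mpr ⟨e, by simp [hT, he]⟩, ?_⟩
      have hlt : T.card < (Finset.univ : Finset (Fin N)).card :=
        Finset.card_lt_card (Finset.filter_ssubset.mpr ⟨c, Finset.mem_univ c, by simp [hc, h1m1]⟩)
      simpa [hk] using hlt
    rcases hχval a with ha | ha <;> rcases hχval b with hb | hb
    · exact absurd (ha.trans hb.symm) hχab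
    · exact key a b ha hb
    · exact key b a hb ha
    · exact absurd (ha.trans hb.symm) hχab
  -- one permutation for each `k`-subset
  have hσ : ∀ S : Finset.powersetCard k (Finset.univ : Finset (Fin N)),
      ∃ σ : Equiv.Perm (Fin N), T.map σ.toEmbedding = S := fun S =>
    Equiv.Perm.exists_map_finset_eq T S (Finset.mem_powersetCard.mp S.2).2.symm
  choose σ hσ using hσ
  set vec : Finset.powersetCard k (Finset.univ : Finset (Fin N)) → V := fun S => g (σ S) v
    with hvec_def
  set ch : Finset.powersetCard k (Finset.univ : Finset (Fin N)) → Fin N → K :=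
    fun S i => χ ((σ S).symm i) with hch_def
  have hvec : ∀ S i, A i (vec S) = ch S i • vec S := by
    intro S i
    have h1 := hconj (σ S) ((σ S).symm i)
    rw [Equiv.apply_symm_apply] at h1
    simp only [hvec_def, hch_def]
    rw [← Module.End.mul_apply, ← h1, Module.End.mul_apply, hχ, map_smul]
  have hvec0 : ∀ S, vec S ≠ 0 := fun S h => hv0 (hg (σ S) (by rw [map_zero]; exact h))
  have hchinj : Function.Injective ch := by
    intro S S' h
    apply Subtype.ext
    rw [← hσ S, ← hσ S']
    ext i
    have hi := congrFun h i
    simp only [hch_def] at hi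
    simp only [Finset.mem_map_equiv, hT, Finset.mem_filter, Finset.mem_univ, true_and, hi]
  -- joint eigenvectors with distinct characters are linearly independent
  have hind := Module.End.independent_iInf_maxGenEigenspace_of_forall_mapsTo A
    (fun i j φ => Module.End.mapsTo_maxGenEigenspace_of_comm (hcomm j i) φ)
  have hmem : ∀ S, vec S ∈ ((fun χ' : Fin N → K => ⨅ i, (A i).maxGenEigenspace (χ' i)) ∘ ch) S := by
    intro S
    simp only [Function.comp_apply, Submodule.mem_iInf, Module.End.mem_maxGenEigenspace]
    exact fun i => ⟨1, by simp [hvec S i]⟩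
  have hli : LinearIndependent K vec := (hind.comp hchinj).linearIndependent _ hmem hvec0
  have hcard := hli.fintype_card_le_finrank
  rw [Fintype.card_coe, Finset.card_powersetCard, Finset.card_univ, Fintype.card_fin] at hcard
  have hle := le_choose_of_one_le_of_lt N k hk1.1 hk1.2
  omega

end Literature.Barriers.QuantumAdvantage
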